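import Summits.QuantumFields.YangMills.Theorems.ToronSmallBallOwnAxisShiftLocal
import Summits.QuantumFields.YangMills.Theorems.ToronSmallBallOwnAxisShiftAngle
import HarnessLib

/-!
# Quaternion bookkeeping for the seam-axis sheet shift: commutators, coaxial rotations, the size of a small rotation

Support module (`--supports` stmt-QuantumFields-23948, `QuantileBitPurity.HolonomyQuantileSubQuartic`; seat ym-dw-p1 g16, plan HOME
`bc/g15-dw/PLAN-CORE-GAXIS.md`).  Pure `SU(2)` ∕ quaternion algebra (`q = su2Quat`, `expPoint v = exp(ι v)`, `axisVec W = Im q_W/‖Im q_W‖`), no lattice: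

* §1 commutators: `‖p u − u p‖ ≤ 2 ‖Im p‖ ‖u − 1‖` (only the imaginary part of `p` and the distance of `u` to `1` matter),
  `‖[a, u] − [b, u]‖ ≤ 2 ‖a − b‖ ‖u − 1‖`, conjugation invariance, and the dictionary `‖q_a − q_{V a V⁻¹}‖ = ‖q_a q_V − q_V q_a‖`;
* §2 ★ the COAXIAL IDENTITY: for a non-central `W` and the rotation `e = exp(ι θ · axisVec W)` about ITS axis,
  `p q_e − q_e p = (sin θ/‖Im q_W‖) · (p q_W − q_W p)` for every quaternion `p` — so `e` commutes with whatever (almost) commutes with `W`, at the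
  rate `|θ|/‖Im q_W‖` (`norm_comm_rot_le`), and with `W` itself (`comm_rot_self`);
* §3 the size of a small rotation about a unit axis `a`: `‖q_{exp(ι θ a)} − 1‖ ≤ |θ|` and, for `0 ≤ θ ≤ 1`, `vacDist (exp(ι θ a)) ≥ (4/3) θ`
  (the rotated centre is OUTSIDE the core of radius `< (2/3) θ`).

HONEST FRAMING: elementary algebra on one compact group; nothing about lattice gauge theory, infinite volume, the continuum limit or the Clay gap.
No `sorry`, no new axiom, no new definition.  References: [folklore]; [cite: Luscher1983, §2] (where it is used).
-/

set_option autoImplicit false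

noncomputable section

open scoped Quaternion
open NormedSpace
open Literature.MathematicalPhysics.QuantumLattice (su2Quat su2Quat_ne_zero norm_su2Quat)
open Literature.MathematicalPhysics.QuantumFieldTheory
open Literature.MathematicalPhysics.QuantumFieldTheory.Balaban1983to89.T4HaarSU2ExpChart (expPoint imQuat imQuat_apply su2Quat_expPoint
  exp_imQuat_smul norm_imQuat)
open Literature.MathematicalPhysics.QuantumFieldTheory.Balaban1983to89.T4HaarSU2Translate (su2Quat_mul su2Quat_one)

namespace Summit.QuantumFields.YangMills.Theorems.FemtoTransferGap.GAxis

open ClassShift OwnAxis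

/-! ## §1 Commutators -/

/-- The commutator only sees the imaginary part: `p u − u p = (Im p) u − u (Im p)`. [folklore] -/
theorem comm_eq_im_comm (p u : ℍ) : p * u - u * p = p.im * u - u * p.im := by
  have hc : (p.re : ℍ) * u = u * (p.re : ℍ) := Quaternion.coe_commutes p.re u
  calc p * u - u * p = ((p.re : ℍ) + p.im) * u - u * ((p.re : ℍ) + p.im) := by rw [Quaternion.re_add_im]
    _ = p.im * u - u * p.im := by rw [add_mul, mul_add, hc]; abel

/-- The commutator only sees the imaginary part of the second factor: `p q − q p = p (Im q) − (Im q) p`. [folklore] -/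
theorem comm_eq_comm_im (p q : ℍ) : p * q - q * p = p * q.im - q.im * p := by
  have hc : (q.re : ℍ) * p = p * (q.re : ℍ) := Quaternion.coe_commutes q.re p
  calc p * q - q * p = p * ((q.re : ℍ) + q.im) - ((q.re : ℍ) + q.im) * p := by rw [Quaternion.re_add_im]
    _ = p * q.im - q.im * p := by rw [add_mul, mul_add, hc]; abel

/-- ★ `‖p u − u p‖ ≤ 2 ‖Im q_p‖ ‖u − 1‖` (as `imVec`: `‖imVec p‖ = ‖Im p‖`). [folklore] -/
theorem norm_comm_le (p u : ℍ) : ‖p * u - u * p‖ ≤ 2 * ‖imVec p‖ * ‖u - 1‖ := by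
  rw [comm_eq_im_comm, norm_imVec]
  have h : p.im * u - u * p.im = p.im * (u - 1) - (u - 1) * p.im := by noncomm_ring
  rw [h]
  calc ‖p.im * (u - 1) - (u - 1) * p.im‖ ≤ ‖p.im * (u - 1)‖ + ‖(u - 1) * p.im‖ := norm_sub_le _ _
    _ ≤ ‖p.im‖ * ‖u - 1‖ + ‖u - 1‖ * ‖p.im‖ := add_le_add (norm_mul_le _ _) (norm_mul_le _ _)
    _ = 2 * ‖p.im‖ * ‖u - 1‖ := by ring

/-- ★ **Commutators are Lipschitz in the first slot against `u − 1`**: `‖(a u − u a) − (b u − u b)‖ ≤ 2 ‖a − b‖ ‖u − 1‖`. [folklore] -/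
theorem norm_comm_sub_comm_le (a b u : ℍ) : ‖(a * u - u * a) - (b * u - u * b)‖ ≤ 2 * ‖a - b‖ * ‖u - 1‖ := by
  have h : (a * u - u * a) - (b * u - u * b) = (a - b) * (u - 1) - (u - 1) * (a - b) := by noncomm_ring
  rw [h]
  calc ‖(a - b) * (u - 1) - (u - 1) * (a - b)‖ ≤ ‖(a - b) * (u - 1)‖ + ‖(u - 1) * (a - b)‖ := norm_sub_le _ _
    _ ≤ ‖a - b‖ * ‖u - 1‖ + ‖u - 1‖ * ‖a - b‖ := add_le_add (norm_mul_le _ _) (norm_mul_le _ _)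
    _ = 2 * ‖a - b‖ * ‖u - 1‖ := by ring

/-- The same with the roles of the slots exchanged: `‖(u a − a u) − (u b − b u)‖ ≤ 2 ‖a − b‖ ‖u − 1‖`. [folklore] -/
theorem norm_comm_sub_comm_le' (a b u : ℍ) : ‖(u * a - a * u) - (u * b - b * u)‖ ≤ 2 * ‖a - b‖ * ‖u - 1‖ := by
  have h : (u * a - a * u) - (u * b - b * u) = -((a * u - u * a) - (b * u - u * b)) := by noncomm_ring
  rw [h, norm_neg]
  exact norm_comm_sub_comm_le a b u

/-- **Conjugation dictionary**: `‖q_a − q_{V a V⁻¹}‖ = ‖q_a q_V − q_V q_a‖`. [folklore] -/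
theorem norm_sub_conj_eq_norm_comm (a V : Matrix.specialUnitaryGroup (Fin 2) ℂ) :
    ‖su2Quat a - su2Quat (V * a * V⁻¹)‖ = ‖su2Quat a * su2Quat V - su2Quat V * su2Quat a‖ := by
  have hV : ‖su2Quat V‖ = 1 := norm_su2Quat V
  have hV0 : su2Quat V ≠ 0 := su2Quat_ne_zero V
  rw [su2Quat_mul, su2Quat_mul, su2Quat_inv]
  have h : su2Quat a - su2Quat V * su2Quat a * (su2Quat V)⁻¹ = (su2Quat a * su2Quat V - su2Quat V * su2Quat a) * (su2Quat V)⁻¹ := by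
    rw [sub_mul, mul_assoc (su2Quat a), mul_inv_cancel₀ hV0, mul_one]
  rw [h, norm_mul, norm_inv, hV, inv_one, mul_one]

/-- Conjugation is an isometry of the quaternion model: `‖q_{W⁻¹ a W} − q_{W⁻¹ b W}‖ = ‖q_a − q_b‖`. [folklore] -/
theorem norm_su2Quat_conj_sub_conj (W a b : Matrix.specialUnitaryGroup (Fin 2) ℂ) :
    ‖su2Quat (W⁻¹ * a * W) - su2Quat (W⁻¹ * b * W)‖ = ‖su2Quat a - su2Quat b‖ := by
  have hW : ‖su2Quat W‖ = 1 := norm_su2Quat W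
  rw [su2Quat_mul, su2Quat_mul, su2Quat_mul, su2Quat_mul, su2Quat_inv]
  have h : (su2Quat W)⁻¹ * su2Quat a * su2Quat W - (su2Quat W)⁻¹ * su2Quat b * su2Quat W =
      (su2Quat W)⁻¹ * (su2Quat a - su2Quat b) * su2Quat W := by noncomm_ring
  rw [h, norm_mul, norm_mul, norm_inv, hW, inv_one, one_mul, mul_one]

/-- The same for `W a W⁻¹`. [folklore] -/
theorem norm_su2Quat_conj_sub_conj' (W a b : Matrix.specialUnitaryGroup (Fin 2) ℂ) :
    ‖su2Quat (W * a * W⁻¹) - su2Quat (W * b * W⁻¹)‖ = ‖su2Quat a - su2Quat b‖ := by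
  have h := norm_su2Quat_conj_sub_conj W⁻¹ a b
  rwa [inv_inv] at h

/-- Commutator norms are conjugation invariant: `‖q_{W⁻¹aW} q_{W⁻¹uW} − q_{W⁻¹uW} q_{W⁻¹aW}‖ = ‖q_a q_u − q_u q_a‖`. [folklore] -/
theorem norm_comm_conj (W a u : Matrix.specialUnitaryGroup (Fin 2) ℂ) :
    ‖su2Quat (W⁻¹ * a * W) * su2Quat (W⁻¹ * u * W) - su2Quat (W⁻¹ * u * W) * su2Quat (W⁻¹ * a * W)‖ =
      ‖su2Quat a * su2Quat u - su2Quat u * su2Quat a‖ := by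
  have h1 : su2Quat (W⁻¹ * a * W) * su2Quat (W⁻¹ * u * W) = su2Quat (W⁻¹ * (a * u) * W) := by
    rw [← su2Quat_mul]; congr 1; group
  have h2 : su2Quat (W⁻¹ * u * W) * su2Quat (W⁻¹ * a * W) = su2Quat (W⁻¹ * (u * a) * W) := by
    rw [← su2Quat_mul]; congr 1; group
  rw [h1, h2, norm_su2Quat_conj_sub_conj, su2Quat_mul, su2Quat_mul]

/-- A commutator with a near-central element: `‖q_p q_u − q_u q_p‖ ≤ 2 ‖Im q_p‖ · ‖q_u − 1‖`. [folklore] -/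
theorem norm_comm_su2Quat_le (p u : Matrix.specialUnitaryGroup (Fin 2) ℂ) :
    ‖su2Quat p * su2Quat u - su2Quat u * su2Quat p‖ ≤ 2 * ‖imVec (su2Quat p)‖ * ‖su2Quat u - 1‖ :=
  norm_comm_le _ _

/-- The symmetric form: `‖q_u q_p − q_p q_u‖ ≤ 2 ‖Im q_p‖ · ‖q_u − 1‖`. [folklore] -/
theorem norm_comm_su2Quat_le' (p u : Matrix.specialUnitaryGroup (Fin 2) ℂ) :
    ‖su2Quat u * su2Quat p - su2Quat p * su2Quat u‖ ≤ 2 * ‖imVec (su2Quat p)‖ * ‖su2Quat u - 1‖ := by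
  rw [← norm_neg, show -(su2Quat u * su2Quat p - su2Quat p * su2Quat u) = su2Quat p * su2Quat u - su2Quat u * su2Quat p by abel]
  exact norm_comm_le _ _

/-! ## §2 The coaxial identity -/

/-- The quaternion of the rotation about the axis of a non-central `W`: `q_{exp(ι θ axis W)} = cos θ + (sin θ/‖Im q_W‖) · Im q_W`. [folklore] -/
theorem su2Quat_rot_eq (θ : ℝ) {W : Matrix.specialUnitaryGroup (Fin 2) ℂ} (hW : imVec (su2Quat W) ≠ 0) :
    su2Quat (expPoint (θ • axisVec W)) = (Real.cos θ : ℍ) + (Real.sin θ / ‖imVec (su2Quat W)‖) • (su2Quat W).im := by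
  rw [su2Quat_expPoint_axisVec θ hW]
  -- `ι(imVec q) = Im q` (tree: `T4ExpWindowSmallField.imQuat_imVec` for its copy of `imVec`; one line keeps that import out)
  have himv : imQuat (imVec (su2Quat W)) = (su2Quat W).im := by ext <;> simp [imQuat_apply, imVec, Quaternion.im]
  unfold axisVec
  rw [map_smul, himv, smul_smul, div_eq_mul_inv]

/-- ★ **The coaxial identity**: `p q_e − q_e p = (sin θ/‖Im q_W‖) · (p q_W − q_W p)` for `e = exp(ι θ axis W)`, `W` non-central. [folklore] -/
theorem comm_rot_eq (θ : ℝ) {W : Matrix.specialUnitaryGroup (Fin 2) ℂ} (hW : imVec (su2Quat W) ≠ 0) (p : ℍ) :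
    p * su2Quat (expPoint (θ • axisVec W)) - su2Quat (expPoint (θ • axisVec W)) * p =
      (Real.sin θ / ‖imVec (su2Quat W)‖) • (p * su2Quat W - su2Quat W * p) := by
  rw [su2Quat_rot_eq θ hW, comm_eq_comm_im p (su2Quat W)]
  have hc : ((Real.cos θ : ℝ) : ℍ) * p = p * ((Real.cos θ : ℝ) : ℍ) := Quaternion.coe_commutes _ p
  rw [mul_add, add_mul, mul_smul_comm, smul_mul_assoc, hc, smul_sub]
  abel

/-- ★ **Rate form**: if `σ ≤ ‖Im q_W‖` with `σ > 0`, then `‖p q_e − q_e p‖ ≤ (|θ|/σ) ‖p q_W − q_W p‖`. [folklore] -/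
theorem norm_comm_rot_le (θ : ℝ) {W : Matrix.specialUnitaryGroup (Fin 2) ℂ} {σ : ℝ} (hσ : 0 < σ) (hσW : σ ≤ ‖imVec (su2Quat W)‖) (p : ℍ) :
    ‖p * su2Quat (expPoint (θ • axisVec W)) - su2Quat (expPoint (θ • axisVec W)) * p‖ ≤ |θ| / σ * ‖p * su2Quat W - su2Quat W * p‖ := by
  have hW : imVec (su2Quat W) ≠ 0 := fun h => by rw [h, norm_zero] at hσW; linarith
  rw [comm_rot_eq θ hW p, norm_smul, Real.norm_eq_abs, abs_div, abs_of_pos (hσ.trans_le hσW)]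
  refine mul_le_mul_of_nonneg_right ?_ (norm_nonneg _)
  calc |Real.sin θ| / ‖imVec (su2Quat W)‖ ≤ |θ| / ‖imVec (su2Quat W)‖ := div_le_div_of_nonneg_right Real.abs_sin_le_abs (hσ.le.trans hσW)
    _ ≤ |θ| / σ := div_le_div_of_nonneg_left (abs_nonneg θ) hσ hσW

/-- The symmetric rate form: `‖q_e p − p q_e‖ ≤ (|θ|/σ) ‖q_W p − p q_W‖`. [folklore] -/
theorem norm_comm_rot_le' (θ : ℝ) {W : Matrix.specialUnitaryGroup (Fin 2) ℂ} {σ : ℝ} (hσ : 0 < σ) (hσW : σ ≤ ‖imVec (su2Quat W)‖) (p : ℍ) :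
    ‖su2Quat (expPoint (θ • axisVec W)) * p - p * su2Quat (expPoint (θ • axisVec W))‖ ≤ |θ| / σ * ‖su2Quat W * p - p * su2Quat W‖ := by
  rw [← norm_neg, neg_sub, ← norm_neg (su2Quat W * p - p * su2Quat W), neg_sub]
  exact norm_comm_rot_le θ hσ hσW p

/-- ★ **The rotation commutes with its reference element**: `q_W q_e − q_e q_W = 0` for `e = exp(ι θ axis W)` (any `W`; at the centre `e = 1`).
[folklore] -/
theorem comm_rot_self (θ : ℝ) (W : Matrix.specialUnitaryGroup (Fin 2) ℂ) :
    su2Quat W * su2Quat (expPoint (θ • axisVec W)) - su2Quat (expPoint (θ • axisVec W)) * su2Quat W = 0 := by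
  by_cases hW : imVec (su2Quat W) = 0
  · have h0 : axisVec W = 0 := by unfold axisVec; rw [hW, smul_zero]
    rw [h0, smul_zero, Literature.MathematicalPhysics.QuantumFieldTheory.Balaban1983to89.T4HaarSU2ExpChart.expPoint_zero, su2Quat_one,
      mul_one, one_mul, sub_self]
  · rw [comm_rot_eq θ hW, sub_self, smul_zero]

/-! ## §3 The size of a small rotation -/

/-- ★ `‖q_{exp(ι θ a)} − 1‖ ≤ |θ|` for a unit axis `a`. [folklore] -/
theorem norm_su2Quat_expPoint_sub_one_le {a : EuclideanSpace ℝ (Fin 3)} (ha : ‖a‖ = 1) (θ : ℝ) :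
    ‖su2Quat (expPoint (θ • a)) - 1‖ ≤ |θ| := by
  rw [su2Quat_expPoint, exp_imQuat_smul ha]
  -- `‖(cos θ − 1) + sin θ ι a‖² = (cos θ − 1)² + sin² θ = 2 − 2 cos θ ≤ θ²`
  have hsq : ‖((Real.cos θ : ℍ) + Real.sin θ • imQuat a) - 1‖ ^ 2 = 2 - 2 * Real.cos θ := by
    rw [sq, ← Quaternion.normSq_eq_norm_mul_self, Quaternion.normSq_def']
    have ha2 : a 0 ^ 2 + a 1 ^ 2 + a 2 ^ 2 = 1 := by
      have h := ha
      rw [EuclideanSpace.norm_eq, Real.sqrt_eq_one, Fin.sum_univ_three] at h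
      simp only [Real.norm_eq_abs, sq_abs] at h
      exact h
    simp [imQuat_apply]
    nlinarith [Real.sin_sq_add_cos_sq θ]
  have hcos : 2 - 2 * Real.cos θ ≤ θ ^ 2 := by have := Real.one_sub_sq_div_two_le_cos (x := θ); linarith
  have h2 : ‖((Real.cos θ : ℍ) + Real.sin θ • imQuat a) - 1‖ ^ 2 ≤ |θ| ^ 2 := by rw [hsq, sq_abs]; exact hcos
  exact (pow_le_pow_iff_left₀ (norm_nonneg _) (abs_nonneg θ) two_ne_zero).1 h2

/-- ★ **The rotated centre leaves the core**: for a unit axis `a` and `0 ≤ θ ≤ 1`, `(4/3) θ ≤ vacDist (exp(ι θ a))`. [folklore] -/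
theorem vacDist_expPoint_ge {a : EuclideanSpace ℝ (Fin 3)} (ha : ‖a‖ = 1) {θ : ℝ} (h0 : 0 ≤ θ) (h1 : θ ≤ 1) :
    4 / 3 * θ ≤ vacDist (expPoint (θ • a)) := by
  have hn : ‖θ • a‖ = θ := by rw [norm_smul, ha, mul_one, Real.norm_eq_abs, abs_of_nonneg h0]
  have hsq := vacDist_expPoint_sq (θ • a)
  rw [hn] at hsq
  -- `cos θ ≤ 1 − θ²/2 + (5/96) θ⁴` and `cos θ ≥ 0`
  have hcb := Real.cos_bound (x := θ) (by rw [abs_of_nonneg h0]; exact h1)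
  rw [abs_of_nonneg h0] at hcb
  have hcos_le : Real.cos θ ≤ 1 - θ ^ 2 / 2 + θ ^ 4 * (5 / 96) := by have := (abs_le.1 hcb).2; linarith
  have hcos0 : 0 ≤ Real.cos θ := Real.cos_nonneg_of_mem_Icc ⟨by linarith [Real.pi_gt_three], by linarith [Real.pi_gt_three]⟩
  rw [abs_of_nonneg hcos0] at hsq
  have hθ4 : θ ^ 4 ≤ θ ^ 2 := by
    have : θ ^ 2 ≤ 1 := by nlinarith
    nlinarith [sq_nonneg θ]
  have hlow : (4 / 3 * θ) ^ 2 ≤ vacDist (expPoint (θ • a)) ^ 2 := by rw [hsq]; nlinarith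
  exact (pow_le_pow_iff_left₀ (by positivity) (vacDist_nonneg _) two_ne_zero).1 hlow

end Summit.QuantumFields.YangMills.Theorems.FemtoTransferGap.GAxis

end
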